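import Literature.NumberTheory.LFunctions.ChebyshevHalfLineBiasThm6iiiProofs
import HarnessLib

/-!
# Suzuki 2025, Thm 6 (v) AS PRINTED, characterised: the only possible limit of `G(x)/log x` is `−(2φ(q))^{-1}Σ_χ m_χ` — «nothing here bears on the truth of RH»
# and the named fact `Suzuki2025Chebyshev_thm6_limits` AS TYPED ⟺ «∀q: GRH mod q ⟹ φ(q) = 1 ∨ no `L(s, χ)` mod `q` vanishes at `½`»

LINE 1 — LABEL: RH-FREE literature (kernel bookkeeping around GRH-EQUIVALENCES; the mean-value lemmas are GRH-CONDITIONAL,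
the characterisations are unconditional equivalences). bears_on: LADDER-RH COLUMN 1 SCREW (S-C, criterion rung; as-printed
audit of the named fact `Suzuki2025Chebyshev_thm6_limits`). WHAT THIS IS NOT: not a route, not progress toward RH or GRH;
nothing here bears on the truth of RH.

M. Suzuki, *On variants of Chebyshev's conjecture*, Ramanujan J. **68** (2025), no. 4, art. 95 = arXiv:2411.07436
[`Suzuki2025Chebyshev`], §1.3 **Theorem 6 (v)**, AS PRINTED: «… we have
`lim_{x→∞} (1/log x) Σ_{n ≤ xe², n ≡ 1 mod q} Λ(n)/√n (1 − log n/log x) = −½ Σ_{χ mod q} m_χ` (1.29) if and only if the GRH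
for `L(s, χ)` holds for all Dirichlet characters `χ` modulo `q` and `Σ_χ Σ_{ρ_{χ*}} x^{ρ_{χ*}}/ρ_{χ*} = o(√x (log x)²)` (1.30)
…». The companion file `ChebyshevHalfLineBiasThm6iiiProofs.lean` proves (v) with the corrected limit `−(2φ(q))^{-1}Σ_χ m_χ`
(`SuzukiThm6iii.Suzuki2025Chebyshev_thm6_v_corrected`; the print drops the factor `φ(q)^{-1}` of (1.23)/(5.2), as in (1.28))
and the printed clause whenever `φ(q) = 1 ∨ Σ_χ m_χ = 0`. THIS FILE closes the as-printed audit: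

* `eq_of_tendsto_cutoff_div_log` — if `G(x)/log x := (1/log x) Σ_{n ≤ xe², n ≡ 1 (q)} Λ(n)n^{-1/2}(1 − log n/log x)` converges
  to ANY `ℓ`, then `ℓ = −(2φ(q))^{-1}Σ_χ m_χ`;
* `Suzuki2025Chebyshev_thm6_v_as_printed_iff` — the typed clause 4 (printed limit `−½Σ_χ m_χ`) holds iff
  GRH(∀χ mod q) ∧ (1.30) ∧ (`φ(q) = 1 ∨ Σ_χ m_χ = 0`);
* `sum_zeroOrder_eq_zero_iff` — `Σ_χ m_χ = 0 ⟺ ∀χ, L(½, χ) ≠ 0` (`m_{χ₀} = 0` since `ζ(½) ≠ 0`);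
* `Suzuki2025Chebyshev_thm6_limits_iff` — the named fact AS TYPED holds iff for every `q ≥ 1`, GRH for all `χ` mod `q`
  implies `φ(q) = 1` or `L(½, χ) ≠ 0` for every `χ` mod `q` (clauses 1–2 are the theorems `Suzuki2025Chebyshev_thm6_ii`,
  `SuzukiThm6iii.Suzuki2025Chebyshev_thm6_iii`; clauses 3–4 reduce by `SuzukiThm6iv.Suzuki2025Chebyshev_thm6_iv_as_printed_iff` and
  the present file). The right-hand side is OPEN (central non-vanishing of Dirichlet `L`-functions is expected, unproved,
  even under GRH): the typed fact is neither dischargeable nor refutable today. Recorded for the referee.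

## Mechanism (§5.1 of the paper run backwards through a mean value)
* Abel summation (MV Appendix A (A.6); Mathlib `sum_mul_eq_sub_integral_mul₀`): `∫_1^Y Π_ψ(t) dt/t = f_ψ(Y)`
  (`integral_inv_mul_primeCountChar_eq_halfLineSum`, `integral_inv_mul_primeCount_eq`).
* GRH mean values: `ψ(t, χ)/√t = Π_χ(t) + m_χ log t + O(1)` (`SuzukiThm6iii.exists_norm_primeCountChar_sub_le`) and
  `f_χ(Y) = −m_χ log²Y/2 − c₀ log Y + O(1)` ((4.5'), `SuzukiThm6iii.exists_norm_halfLineSum_add_le_of_GRH''`) make the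
  `m_χ log²Y/2` cancel: `‖∫_1^Y ψ(t, χ) dt/(t√t)‖ ≤ C(1 + log Y)` (`exists_norm_integral_psiChar_le`); likewise
  `(ψ(t) − t)/√t = Π(t) − 2√t + O(1)` and `f_ζ(Y) = 4√Y + O(log Y)` under RH (`exists_abs_integral_psi_sub_le`); summed over
  characters, `‖∫_1^Y A(t) dt/(t√t)‖ ≤ C(1 + log Y)` with `A = (ψ − id) + Σ_{χ≠χ₀} ψ(·, χ*)` (`exists_norm_integral_A_le`).
* KEY ESTIMATE 1 of the companion file (`SuzukiThm6iii.exists_norm_cutoff_sub_le`) turns a limit `ℓ` of `G(x)/log x` into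
  `‖A(y)/(y√y) − κ(log y − 2)²/y‖ ≤ (|κ|/4)(log y − 2)²/y` for large `y`, `κ = −(φ(q)ℓ + Σ_χ m_χ/2)/2`; integrating over
  `[Y₀, Y₀eˢ]` gives `≍ |κ|s³` against the `O(s)` mean value, so `κ = 0`.

Theorems only (D-0014/D-0026): no definitions, no named facts, no instances, no notation.

## References
* [Suzuki2025Chebyshev] M. Suzuki, Ramanujan J. 68 (2025) 95 = arXiv:2411.07436: §1.3 Thm 6 (iv)–(v) (1.28)–(1.30), the
  sentence after Thm 6 («If `L(1/2, χ) ≠ 0` … the right-hand sides of (1.28) and (1.29) vanish»); §5.1; §4.1 (4.5').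
* [MontgomeryVaughan2007] H. L. Montgomery, R. C. Vaughan, *Multiplicative Number Theory I*, CUP 2007: Appendix A, Thm A.2
  and eq. (A.6) (Abel summation); (13.41); Thms 12.5, 12.10.
-/

noncomputable section

open Complex Filter Topology Set MeasureTheory ArithmeticFunction
open scoped Real

namespace Literature.NumberTheory.LFunctions

namespace SuzukiThm6vAsPrinted

open ExplicitPsiChar HalfLineRiesz HalfLineRieszImprimitive SuzukiThm6iii

variable {q : ℕ} [NeZero q] {χ : DirichletCharacter ℂ q}

/-! ## §0 Plumbing repeated from the companion file (private there) -/

/-- What holds for all large `xe²` holds for all large `y`. [folklore] -/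
private theorem eventually_of_mul_exp_two {P : ℝ → Prop} (h : ∀ᶠ x : ℝ in atTop, P (x * Real.exp 2)) :
    ∀ᶠ y : ℝ in atTop, P y := by
  obtain ⟨a, ha⟩ := Filter.eventually_atTop.1 h
  refine Filter.eventually_atTop.2 ⟨a * Real.exp 2, fun y hy ↦ ?_⟩
  have he : 0 < Real.exp 2 := Real.exp_pos 2
  have := ha (y / Real.exp 2) (by rw [le_div_iff₀ he]; exact hy)
  rwa [div_mul_cancel₀ _ he.ne'] at this

/-- `ψ(y, χ) = Σ_{1 ≤ n ≤ y} Λ(n)χ(n)` as a sum over `Finset.Icc 1 ⌊y⌋₊` (the `n = 0` term vanishes). [folklore] -/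
private theorem chebyshevPsiChar_eq_sum_Icc {N : ℕ} (ψ : DirichletCharacter ℂ N) (y : ℝ) :
    Sieve.chebyshevPsiChar ψ y = ∑ n ∈ Finset.Icc 1 ⌊y⌋₊, (Λ n : ℂ) * ψ n := by
  rw [Sieve.chebyshevPsiChar, Finset.range_eq_Ico, Finset.sum_eq_sum_Ico_succ_bot (Nat.succ_pos _)]
  simp only [Nat.cast_zero, ArithmeticFunction.map_zero, Complex.ofReal_zero, mul_zero, zero_add]
  rw [show Finset.Ico 1 (⌊y⌋₊ + 1) = Finset.Icc 1 ⌊y⌋₊ from rfl]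
  exact Finset.sum_congr rfl fun n _ ↦ mul_comm _ _

/-- GRH for the principal character mod `q` gives RH. [folklore] -/
private theorem riemannHypothesis_of_principal
    (h : (1 : DirichletCharacter ℂ q).RiemannHypothesis) : RiemannHypothesis := by
  refine riemannHypothesis_iff_strip_holds.2 fun s hs h0 h1 ↦ h s ?_ h0 h1
  have hs1 : s ≠ 1 := fun h ↦ by rw [h, Complex.one_re] at h1; exact lt_irrefl _ h1
  have key := DirichletCharacter.LFunction_changeLevel (one_dvd q) (1 : DirichletCharacter ℂ 1) (s := s) (Or.inr hs1)
  rw [DirichletCharacter.changeLevel_one, DirichletCharacter.LFunction_modOne_eq, hs, zero_mul] at key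
  exact key

/-! ## §1–§3 The clause (v) AS PRINTED, characterised: under any limit of `G(x)/log x` the limit is `−(2φ(q))^{-1}Σ_χ m_χ`

The mean value `∫_1^Y A(t) t^{-3/2} dt` is `O(log Y)` under GRH (Abel summation turns `∫_1^Y Π_χ(t)dt/t` into the Riesz
mean `f_χ(Y)`, whose `m_χ log²Y/2` cancels the one from `Π_χ − ψ(·,χ)/√· = −m_χ log + O(1)`), whereas a limit
`G(x)/log x → ℓ ≠ −(2φ)^{-1}Σ_χ m_χ` would force `A(y) ~ κ√y log²y` with `κ ≠ 0` (KEY ESTIMATE 1), whose mean value grows like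
`log³Y`. (As-printed audit of (1.29); RH-FREE bookkeeping of a GRH-EQUIVALENCE; nothing here bears on the truth of RH.) -/

section AsPrinted

open DirichletCharacter

/-! ### §1 Abel summation `∫_1^Y Π_ψ(t) dt/t = f_ψ(Y)`; integrability of the step functions -/

/-- Dropping a vanishing `k = 0` term: `Σ_{0 ≤ k ≤ n} f(k) = Σ_{1 ≤ k ≤ n} f(k)` when `f(0) = 0`. [folklore] -/
private theorem sum_Icc_zero_eq_Icc_one {M : Type*} [AddCommMonoid M] (f : ℕ → M) (hf : f 0 = 0) (n : ℕ) :
    ∑ k ∈ Finset.Icc 0 n, f k = ∑ k ∈ Finset.Icc 1 n, f k :=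
  (Finset.sum_subset (Finset.Icc_subset_Icc_left (Nat.zero_le 1)) fun k hk hk' ↦ by
    have : k = 0 := by
      simp only [Finset.mem_Icc] at hk hk'
      omega
    rw [this, hf]).symm

/-- `t ↦ (t : ℂ)⁻¹` is continuous on `[1, Y]`. [folklore] -/
private theorem continuousOn_inv_Icc (Y : ℝ) : ContinuousOn (fun t : ℝ ↦ (t : ℂ)⁻¹) (Set.Icc 1 Y) :=
  Complex.continuous_ofReal.continuousOn.inv₀ fun t ht ↦ by
    exact_mod_cast (by linarith [ht.1] : t ≠ 0)

/-- `t ↦ (t : ℂ)⁻¹/√t` is continuous on `[1, Y]`. [folklore] -/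
private theorem continuousOn_inv_div_sqrt_Icc (Y : ℝ) :
    ContinuousOn (fun t : ℝ ↦ (t : ℂ)⁻¹ / (Real.sqrt t : ℂ)) (Set.Icc 1 Y) :=
  (continuousOn_inv_Icc Y).div (Complex.continuous_ofReal.comp_continuousOn Real.continuous_sqrt.continuousOn)
    fun t ht ↦ by exact_mod_cast (Real.sqrt_pos.2 (by linarith [ht.1])).ne'

/-- `t ↦ t⁻¹` is continuous on `[1, Y]` (real). [folklore] -/
private theorem continuousOn_inv_Icc_real (Y : ℝ) : ContinuousOn (fun t : ℝ ↦ t⁻¹) (Set.Icc 1 Y) :=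
  continuousOn_id.inv₀ fun t ht ↦ by simp only [id]; linarith [ht.1]

/-- `t ↦ t⁻¹/√t` is continuous on `[1, Y]` (real). [folklore] -/
private theorem continuousOn_inv_div_sqrt_Icc_real (Y : ℝ) :
    ContinuousOn (fun t : ℝ ↦ t⁻¹ / Real.sqrt t) (Set.Icc 1 Y) :=
  (continuousOn_inv_Icc_real Y).div Real.continuous_sqrt.continuousOn
    fun t ht ↦ (Real.sqrt_pos.2 (by linarith [ht.1])).ne'

/-- `Π_ψ(t)/t` is integrable on `[1, Y]`. [folklore] -/
private theorem intervalIntegrable_inv_mul_primeCountChar {N : ℕ} (ψ : DirichletCharacter ℂ N) {Y : ℝ}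
    (hY : 1 ≤ Y) :
    IntervalIntegrable (fun t : ℝ ↦ (t : ℂ)⁻¹ *
      ∑ n ∈ Finset.Icc 1 ⌊t⌋₊, (Λ n : ℂ) * ψ n / (Real.sqrt n : ℂ)) volume 1 Y := by
  rw [intervalIntegrable_iff_integrableOn_Ioc_of_le hY]
  exact (integrableOn_mul_sum_Icc (fun n ↦ (Λ n : ℂ) * ψ n / (Real.sqrt n : ℂ)) zero_le_one
    ((continuousOn_inv_Icc Y).integrableOn_Icc)).mono_set Set.Ioc_subset_Icc_self

/-- `ψ(t, χ)/(t√t)` is integrable on `[1, Y]`. [folklore] -/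
private theorem intervalIntegrable_inv_mul_psiChar {N : ℕ} (ψ : DirichletCharacter ℂ N) {Y : ℝ} (hY : 1 ≤ Y) :
    IntervalIntegrable (fun t : ℝ ↦ (t : ℂ)⁻¹ * (Sieve.chebyshevPsiChar ψ t / (Real.sqrt t : ℂ)))
      volume 1 Y := by
  have h : IntegrableOn (fun t : ℝ ↦ (t : ℂ)⁻¹ / (Real.sqrt t : ℂ) *
      ∑ n ∈ Finset.Icc 1 ⌊t⌋₊, (Λ n : ℂ) * ψ n) (Set.Icc 1 Y) :=
    integrableOn_mul_sum_Icc (fun n ↦ (Λ n : ℂ) * ψ n) zero_le_one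
      ((continuousOn_inv_div_sqrt_Icc Y).integrableOn_Icc)
  rw [intervalIntegrable_iff_integrableOn_Ioc_of_le hY]
  refine (h.mono_set Set.Ioc_subset_Icc_self).congr_fun (fun t _ ↦ ?_) measurableSet_Ioc
  simp only
  rw [chebyshevPsiChar_eq_sum_Icc]
  ring

/-- `Π(t)/t` (real, `ζ` case) is integrable on `[1, Y]`. [folklore] -/
private theorem intervalIntegrable_inv_mul_primeCount {Y : ℝ} (hY : 1 ≤ Y) :
    IntervalIntegrable (fun t : ℝ ↦ t⁻¹ * ∑ n ∈ Finset.Icc 1 ⌊t⌋₊, Λ n / Real.sqrt n) volume 1 Y := by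
  rw [intervalIntegrable_iff_integrableOn_Ioc_of_le hY]
  exact (integrableOn_mul_sum_Icc (fun n ↦ Λ n / Real.sqrt n) zero_le_one
    ((continuousOn_inv_Icc_real Y).integrableOn_Icc)).mono_set Set.Ioc_subset_Icc_self

/-- `ψ(t)/(t√t)` is integrable on `[1, Y]`. [folklore] -/
private theorem intervalIntegrable_inv_mul_psi {Y : ℝ} (hY : 1 ≤ Y) :
    IntervalIntegrable (fun t : ℝ ↦ t⁻¹ * (Chebyshev.psi t / Real.sqrt t)) volume 1 Y := by
  have h : IntegrableOn (fun t : ℝ ↦ t⁻¹ / Real.sqrt t * ∑ n ∈ Finset.Icc 0 ⌊t⌋₊, Λ n) (Set.Icc 1 Y) :=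
    integrableOn_mul_sum_Icc (fun n ↦ Λ n) zero_le_one ((continuousOn_inv_div_sqrt_Icc_real Y).integrableOn_Icc)
  rw [intervalIntegrable_iff_integrableOn_Ioc_of_le hY]
  refine (h.mono_set Set.Ioc_subset_Icc_self).congr_fun (fun t _ ↦ ?_) measurableSet_Ioc
  simp only
  rw [Chebyshev.psi_eq_sum_Icc]
  ring

/-- **Abel summation for the twisted prime-power sums**: `∫_1^Y Π_ψ(t) dt/t = f_ψ(Y)` for `Y ≥ 1`, where
`Π_ψ(t) = Σ_{n ≤ t} Λ(n)ψ(n)n^{-1/2}` and `f_ψ(Y) = Σ_{n ≤ Y} Λ(n)ψ(n)n^{-1/2} log(Y/n)`.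
[cite: MontgomeryVaughan2007, Appendix A, Thm A.2 and eq. (A.6) (Abel summation)] -/
theorem integral_inv_mul_primeCountChar_eq_halfLineSum {N : ℕ} (ψ : DirichletCharacter ℂ N) {Y : ℝ}
    (hY : 1 ≤ Y) :
    ∫ t in (1 : ℝ)..Y, (t : ℂ)⁻¹ * ∑ n ∈ Finset.Icc 1 ⌊t⌋₊, (Λ n : ℂ) * ψ n / (Real.sqrt n : ℂ) =
      halfLineSum ψ Y := by
  have hY0 : 0 < Y := by linarith
  set c : ℕ → ℂ := fun n ↦ (Λ n : ℂ) * ψ n / (Real.sqrt n : ℂ) with hc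
  have hc0 : c 0 = 0 := by simp [hc]
  set f : ℝ → ℂ := fun t ↦ ((Real.log t : ℝ) : ℂ) with hf
  have hderiv : ∀ t : ℝ, 0 < t → HasDerivAt f (t : ℂ)⁻¹ t := fun t ht ↦ by
    have h := (Real.hasDerivAt_log ht.ne').ofReal_comp
    simpa [hf, Complex.ofReal_inv] using h
  have hf_diff : ∀ t ∈ Set.Icc 1 Y, DifferentiableAt ℝ f t := fun t ht ↦
    (hderiv t (by linarith [ht.1])).differentiableAt
  have hderiv_eq : Set.EqOn (deriv f) (fun t : ℝ ↦ (t : ℂ)⁻¹) (Set.Icc 1 Y) := fun t ht ↦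
    (hderiv t (by linarith [ht.1])).deriv
  have hf_int : IntegrableOn (deriv f) (Set.Icc 1 Y) :=
    ((continuousOn_inv_Icc Y).integrableOn_Icc).congr_fun hderiv_eq.symm measurableSet_Icc
  have habel := sum_mul_eq_sub_integral_mul₀ c hc0 Y hf_diff hf_int
  have hI : ∫ t in Set.Ioc 1 Y, deriv f t * ∑ k ∈ Finset.Icc 0 ⌊t⌋₊, c k =
      ∫ t in Set.Ioc 1 Y, (t : ℂ)⁻¹ * ∑ n ∈ Finset.Icc 1 ⌊t⌋₊, c n := by
    refine MeasureTheory.setIntegral_congr_fun measurableSet_Ioc fun t ht ↦ ?_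
    rw [hderiv_eq (Set.Ioc_subset_Icc_self ht), sum_Icc_zero_eq_Icc_one c hc0]
  rw [intervalIntegral.integral_of_le hY, ← hI]
  have h2 : ∫ t in Set.Ioc 1 Y, deriv f t * ∑ k ∈ Finset.Icc 0 ⌊t⌋₊, c k =
      f Y * (∑ k ∈ Finset.Icc 0 ⌊Y⌋₊, c k) - ∑ k ∈ Finset.Icc 0 ⌊Y⌋₊, f k * c k := by
    linear_combination habel
  rw [h2, Finset.mul_sum, ← Finset.sum_sub_distrib,
    sum_Icc_zero_eq_Icc_one (fun k ↦ f Y * c k - f k * c k) (by simp [hc0]), halfLineSum]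
  refine Finset.sum_congr rfl fun n hn ↦ ?_
  have hn1 : 1 ≤ n := (Finset.mem_Icc.1 hn).1
  have hn0 : (0 : ℝ) < n := by exact_mod_cast hn1
  simp only [hf, hc]
  rw [Real.log_div hY0.ne' hn0.ne']
  push_cast
  ring

/-- **Abel summation, `ζ` case (real)**: `∫_1^Y Π(t) dt/t = Σ_{n ≤ Y} Λ(n)n^{-1/2} log(Y/n)` for `Y ≥ 1`.
[cite: MontgomeryVaughan2007, Appendix A, eq. (A.6) (Abel summation)] -/
theorem integral_inv_mul_primeCount_eq {Y : ℝ} (hY : 1 ≤ Y) :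
    ∫ t in (1 : ℝ)..Y, t⁻¹ * ∑ n ∈ Finset.Icc 1 ⌊t⌋₊, Λ n / Real.sqrt n =
      ∑ n ∈ Finset.Icc 1 ⌊Y⌋₊, Λ n / Real.sqrt n * Real.log (Y / n) := by
  have hY0 : 0 < Y := by linarith
  set c : ℕ → ℝ := fun n ↦ Λ n / Real.sqrt n with hc
  have hc0 : c 0 = 0 := by simp [hc]
  have hf_diff : ∀ t ∈ Set.Icc 1 Y, DifferentiableAt ℝ Real.log t := fun t ht ↦
    Real.differentiableAt_log (by linarith [ht.1])
  have hderiv_eq : Set.EqOn (deriv Real.log) (fun t : ℝ ↦ t⁻¹) (Set.Icc 1 Y) := fun t _ ↦ Real.deriv_log t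
  have hf_int : IntegrableOn (deriv Real.log) (Set.Icc 1 Y) :=
    ((continuousOn_inv_Icc_real Y).integrableOn_Icc).congr_fun hderiv_eq.symm measurableSet_Icc
  have habel := sum_mul_eq_sub_integral_mul₀ c hc0 Y hf_diff hf_int
  have hI : ∫ t in Set.Ioc 1 Y, deriv Real.log t * ∑ k ∈ Finset.Icc 0 ⌊t⌋₊, c k =
      ∫ t in Set.Ioc 1 Y, t⁻¹ * ∑ n ∈ Finset.Icc 1 ⌊t⌋₊, c n := by
    refine MeasureTheory.setIntegral_congr_fun measurableSet_Ioc fun t _ ↦ ?_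
    rw [Real.deriv_log, sum_Icc_zero_eq_Icc_one c hc0]
  rw [intervalIntegral.integral_of_le hY, ← hI]
  have h2 : ∫ t in Set.Ioc 1 Y, deriv Real.log t * ∑ k ∈ Finset.Icc 0 ⌊t⌋₊, c k =
      Real.log Y * (∑ k ∈ Finset.Icc 0 ⌊Y⌋₊, c k) - ∑ k ∈ Finset.Icc 0 ⌊Y⌋₊, Real.log k * c k := by
    linear_combination habel
  rw [h2, Finset.mul_sum, ← Finset.sum_sub_distrib,
    sum_Icc_zero_eq_Icc_one (fun k ↦ Real.log Y * c k - Real.log k * c k) (by simp [hc0])]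
  refine Finset.sum_congr rfl fun n hn ↦ ?_
  have hn1 : 1 ≤ n := (Finset.mem_Icc.1 hn).1
  have hn0 : (0 : ℝ) < n := by exact_mod_cast hn1
  simp only [hc]
  rw [Real.log_div hY0.ne' hn0.ne']
  ring

/-- The character mod `1` Riesz mean is the real `ζ`-one: `f_{χ mod 1}(Y) = Σ_{n ≤ Y} Λ(n)n^{-1/2} log(Y/n)`. [folklore] -/
private theorem halfLineSum_modOne (Y : ℝ) :
    halfLineSum (1 : DirichletCharacter ℂ 1) Y =
      ((∑ n ∈ Finset.Icc 1 ⌊Y⌋₊, Λ n / Real.sqrt n * Real.log (Y / n) : ℝ) : ℂ) := by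
  rw [halfLineSum, Complex.ofReal_sum]
  refine Finset.sum_congr rfl fun n _ ↦ ?_
  rw [MulChar.one_apply (isUnit_of_subsingleton _)]
  push_cast
  ring


/-! ### §2 Mean values under GRH: `∫_1^Y ψ(t, χ)dt/(t√t)`, `∫_1^Y (ψ(t) − t)dt/(t√t)`, `∫_1^Y A(t)dt/(t√t)` are `O(log Y)` -/

/-- `∫_1^Y log t · dt/t = log²Y/2` (complex form). [folklore] -/
private theorem integral_log_mul_inv {Y : ℝ} (hY : 1 ≤ Y) :
    ∫ t in (1 : ℝ)..Y, (Real.log t : ℂ) * (t : ℂ)⁻¹ = ((((Real.log Y) ^ 2 / 2 : ℝ)) : ℂ) := by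
  have hcont : ContinuousOn (fun t : ℝ ↦ (Real.log t : ℂ) * (t : ℂ)⁻¹) (Set.uIcc 1 Y) := by
    rw [Set.uIcc_of_le hY]
    exact (Complex.continuous_ofReal.comp_continuousOn
      (Real.continuousOn_log.mono fun t ht ↦ by
        simp only [Set.mem_compl_iff, Set.mem_singleton_iff]; linarith [ht.1])).mul (continuousOn_inv_Icc Y)
  have hderiv : ∀ t ∈ Set.uIcc 1 Y,
      HasDerivAt (fun t : ℝ ↦ ((((Real.log t) * Real.log t / 2 : ℝ)) : ℂ)) ((Real.log t : ℂ) * (t : ℂ)⁻¹) t := by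
    intro t ht
    rw [Set.uIcc_of_le hY] at ht
    have ht0 : t ≠ 0 := by linarith [ht.1]
    have h1 : HasDerivAt (fun t : ℝ ↦ Real.log t * Real.log t / 2) (Real.log t * t⁻¹) t :=
      (((Real.hasDerivAt_log ht0).mul (Real.hasDerivAt_log ht0)).div_const 2).congr_deriv (by ring)
    exact h1.ofReal_comp.congr_deriv (by simp only [Complex.ofReal_mul, Complex.ofReal_inv])
  rw [intervalIntegral.integral_eq_sub_of_hasDerivAt hderiv hcont.intervalIntegrable]
  simp only [Real.log_one, mul_zero, zero_div, Complex.ofReal_zero, sub_zero]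
  push_cast
  ring

/-- **Mean value of `ψ(t, χ)/(t√t)` under GRH** (primitive `χ` mod `q > 1`): `‖∫_1^Y ψ(t, χ) dt/(t√t)‖ ≤ C(1 + log Y)`
for `Y ≥ 1`. Mechanism: `ψ(t, χ)/√t = Π_χ(t) + m_χ log t − E(t)` with `‖E‖ ≤ C₁` (§4), `∫_1^Y Π_χ dt/t = f_χ(Y)` (Abel),
`f_χ(Y) = −m_χ log²Y/2 − c₀ log Y + O(1)` under GRH ((4.5')): the terms `m_χ log²Y/2` cancel. GRH-CONDITIONAL.
[cite: Suzuki2025Chebyshev, §4.1 (4.5') and §5.1; MontgomeryVaughan2007, (13.41)] -/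
theorem exists_norm_integral_psiChar_le (hprim : χ.IsPrimitive) (hq : 1 < q) (hGRH : χ.RiemannHypothesis) :
    ∃ C : ℝ, 0 ≤ C ∧ ∀ Y : ℝ, 1 ≤ Y →
      ‖∫ t in (1 : ℝ)..Y, (t : ℂ)⁻¹ * (Sieve.chebyshevPsiChar χ t / (Real.sqrt t : ℂ))‖ ≤
        C * (1 + Real.log Y) := by
  obtain ⟨C₁, hC₁⟩ := exists_norm_primeCountChar_sub_le hprim hq hGRH
  obtain ⟨c₀, hc₁, hc₂, -⟩ := exists_norm_charFordK_half_le hprim hq hGRH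
  obtain ⟨B, hB⟩ := exists_norm_halfLineSum_add_le_of_GRH'' hprim hq hGRH hc₁ hc₂
  set m : ℂ := (DirichletDisc.zeroOrder χ (1 / 2) : ℂ) with hm
  refine ⟨|C₁| + ‖c₀‖ + |B|, by positivity, fun Y hY ↦ ?_⟩
  rcases eq_or_lt_of_le hY with rfl | hY1
  · simp only [intervalIntegral.integral_same, norm_zero, Real.log_one, add_zero, mul_one]
    positivity
  have hY0 : 0 < Y := by linarith
  have hlY : 0 ≤ Real.log Y := Real.log_nonneg hY
  set P : ℝ → ℂ := fun t ↦ ∑ n ∈ Finset.Icc 1 ⌊t⌋₊, (Λ n : ℂ) * χ n / (Real.sqrt n : ℂ) with hP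
  set E : ℝ → ℂ := fun t ↦ P t - Sieve.chebyshevPsiChar χ t / (Real.sqrt t : ℂ) + m * Real.log t with hE
  have hEb : ∀ t : ℝ, 1 < t → ‖E t‖ ≤ C₁ := fun t ht ↦ hC₁ t ht
  -- integrability
  have hiP : IntervalIntegrable (fun t : ℝ ↦ (t : ℂ)⁻¹ * P t) volume 1 Y :=
    intervalIntegrable_inv_mul_primeCountChar χ hY
  have hiψ := intervalIntegrable_inv_mul_psiChar χ hY
  have hlog_cont : ContinuousOn (fun t : ℝ ↦ (Real.log t : ℂ) * (t : ℂ)⁻¹) (Set.uIcc 1 Y) := by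
    rw [Set.uIcc_of_le hY]
    exact (Complex.continuous_ofReal.comp_continuousOn
      (Real.continuousOn_log.mono fun t ht ↦ by
        simp only [Set.mem_compl_iff, Set.mem_singleton_iff]; linarith [ht.1])).mul (continuousOn_inv_Icc Y)
  have hilog : IntervalIntegrable (fun t : ℝ ↦ (Real.log t : ℂ) * (t : ℂ)⁻¹) volume 1 Y :=
    hlog_cont.intervalIntegrable
  have hiE : IntervalIntegrable (fun t : ℝ ↦ (t : ℂ)⁻¹ * E t) volume 1 Y := by
    have : (fun t : ℝ ↦ (t : ℂ)⁻¹ * E t) = fun t : ℝ ↦ ((t : ℂ)⁻¹ * P t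
        - (t : ℂ)⁻¹ * (Sieve.chebyshevPsiChar χ t / (Real.sqrt t : ℂ))) + m * ((Real.log t : ℂ) * (t : ℂ)⁻¹) := by
      funext t; simp only [hE]; ring
    rw [this]
    exact (hiP.sub hiψ).add (hilog.const_mul m)
  -- evaluation of the pieces
  have hI1 : ∫ t in (1 : ℝ)..Y, (t : ℂ)⁻¹ * P t = halfLineSum χ Y :=
    integral_inv_mul_primeCountChar_eq_halfLineSum χ hY
  have hI2 := integral_log_mul_inv hY
  have hI3 : ‖∫ t in (1 : ℝ)..Y, (t : ℂ)⁻¹ * E t‖ ≤ |C₁| * Real.log Y := by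
    have hb : ∀ᵐ t : ℝ, t ∈ Set.Ioc 1 Y → ‖(t : ℂ)⁻¹ * E t‖ ≤ |C₁| * t⁻¹ := by
      refine Filter.Eventually.of_forall fun t ht ↦ ?_
      have ht0 : 0 < t := by linarith [ht.1]
      rw [norm_mul, norm_inv, Complex.norm_real, Real.norm_eq_abs, abs_of_pos ht0, mul_comm]
      exact mul_le_mul_of_nonneg_right ((hEb t ht.1).trans (le_abs_self _)) (inv_nonneg.2 ht0.le)
    have hg : IntervalIntegrable (fun t : ℝ ↦ |C₁| * t⁻¹) volume 1 Y := by
      refine (ContinuousOn.intervalIntegrable ?_).const_mul |C₁|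
      rw [Set.uIcc_of_le hY]
      exact continuousOn_inv_Icc_real Y
    calc ‖∫ t in (1 : ℝ)..Y, (t : ℂ)⁻¹ * E t‖ ≤ ∫ t in (1 : ℝ)..Y, |C₁| * t⁻¹ :=
          intervalIntegral.norm_integral_le_of_norm_le hY hb hg
      _ = |C₁| * Real.log Y := by
          rw [intervalIntegral.integral_const_mul, integral_inv_of_pos one_pos hY0, div_one]
  -- the decomposition of the integral
  have hsplit : ∫ t in (1 : ℝ)..Y, (t : ℂ)⁻¹ * (Sieve.chebyshevPsiChar χ t / (Real.sqrt t : ℂ)) =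
      (halfLineSum χ Y + m * ((((Real.log Y) ^ 2 / 2 : ℝ)) : ℂ)) - ∫ t in (1 : ℝ)..Y, (t : ℂ)⁻¹ * E t := by
    rw [← hI1, ← hI2, ← intervalIntegral.integral_const_mul, ← intervalIntegral.integral_add hiP (hilog.const_mul m),
      ← intervalIntegral.integral_sub (hiP.add (hilog.const_mul m)) hiE]
    refine intervalIntegral.integral_congr fun t _ ↦ ?_
    simp only [hE]
    ring
  have hmain : ‖halfLineSum χ Y + m * ((((Real.log Y) ^ 2 / 2 : ℝ)) : ℂ)‖ ≤ |B| + Real.log Y * ‖c₀‖ := by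
    have h1 := hB Y hY1
    have h2 : ‖(Real.log Y : ℂ) * c₀‖ = Real.log Y * ‖c₀‖ := by
      rw [norm_mul, Complex.norm_real, Real.norm_eq_abs, abs_of_nonneg hlY]
    calc ‖halfLineSum χ Y + m * ((((Real.log Y) ^ 2 / 2 : ℝ)) : ℂ)‖
        = ‖(halfLineSum χ Y + (Real.log Y : ℂ) * c₀ + m * ((((Real.log Y) ^ 2 / 2 : ℝ)) : ℂ))
            - (Real.log Y : ℂ) * c₀‖ := by ring_nf
      _ ≤ ‖halfLineSum χ Y + (Real.log Y : ℂ) * c₀ + m * ((((Real.log Y) ^ 2 / 2 : ℝ)) : ℂ)‖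
            + ‖(Real.log Y : ℂ) * c₀‖ := norm_sub_le _ _
      _ ≤ |B| + Real.log Y * ‖c₀‖ := by rw [h2]; exact add_le_add (h1.trans (le_abs_self B)) le_rfl
  rw [hsplit]
  calc ‖(halfLineSum χ Y + m * ((((Real.log Y) ^ 2 / 2 : ℝ)) : ℂ)) - ∫ t in (1 : ℝ)..Y, (t : ℂ)⁻¹ * E t‖
      ≤ ‖halfLineSum χ Y + m * ((((Real.log Y) ^ 2 / 2 : ℝ)) : ℂ)‖ + ‖∫ t in (1 : ℝ)..Y, (t : ℂ)⁻¹ * E t‖ :=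
        norm_sub_le _ _
    _ ≤ (|B| + Real.log Y * ‖c₀‖) + |C₁| * Real.log Y := add_le_add hmain hI3
    _ ≤ (|C₁| + ‖c₀‖ + |B|) * (1 + Real.log Y) := by
        have : 0 ≤ ‖c₀‖ := norm_nonneg _
        nlinarith [abs_nonneg B, abs_nonneg C₁]

/-- **Mean value of `(ψ(t) − t)/(t√t)` under RH**: `|∫_1^Y (ψ(t) − t) dt/(t√t)| ≤ C(1 + log Y)` for `Y ≥ 1`:
`(ψ(t) − t)/√t = Π(t) − 2√t − E₁(t)` with `|E₁| ≤ K` (Thm 2 machinery), `∫_1^Y Π dt/t = f_ζ(Y) = 4√Y − (ζ'/ζ)(½)log Y + O(1)`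
under RH ((1.7)/(1.9)), `∫_1^Y 2dt/√t = 4√Y − 4`: the terms `4√Y` cancel. RH-CONDITIONAL.
[cite: Suzuki2025Chebyshev, §1.1 (1.7), (1.9) and §3.1] -/
theorem exists_abs_integral_psi_sub_le (hRH : RiemannHypothesis) :
    ∃ C : ℝ, 0 ≤ C ∧ ∀ Y : ℝ, 1 ≤ Y →
      |∫ t in (1 : ℝ)..Y, t⁻¹ * ((Chebyshev.psi t - t) / Real.sqrt t)| ≤ C * (1 + Real.log Y) := by
  obtain ⟨K, hK⟩ := ChebyshevHalfLineBiasThm2.exists_abs_primeCount_sub_le hRH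
  obtain ⟨K₂, hK₂⟩ := ProgressionsRiesz.exists_norm_halfLineSum_modOne_le_of_RH hRH
  set Lz : ℝ := ‖logDeriv riemannZeta (1 / 2)‖ with hLz
  refine ⟨|K| + |K₂| + Lz + 4, by positivity, fun Y hY ↦ ?_⟩
  rcases eq_or_lt_of_le hY with rfl | hY1
  · simp only [intervalIntegral.integral_same, abs_zero, Real.log_one, add_zero, mul_one]
    positivity
  have hY0 : 0 < Y := by linarith
  have hlY : 0 ≤ Real.log Y := Real.log_nonneg hY
  set P : ℝ → ℝ := fun t ↦ ∑ n ∈ Finset.Icc 1 ⌊t⌋₊, Λ n / Real.sqrt n with hP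
  set E : ℝ → ℝ := fun t ↦ P t - Chebyshev.psi t / Real.sqrt t - Real.sqrt t with hE
  have hEb : ∀ t : ℝ, 1 ≤ t → |E t| ≤ K := fun t ht ↦ hK t ht
  -- integrability
  have hiP : IntervalIntegrable (fun t : ℝ ↦ t⁻¹ * P t) volume 1 Y := intervalIntegrable_inv_mul_primeCount hY
  have hiψ := intervalIntegrable_inv_mul_psi hY
  have hsq_cont : ContinuousOn (fun t : ℝ ↦ t⁻¹ * Real.sqrt t) (Set.uIcc 1 Y) := by
    rw [Set.uIcc_of_le hY]
    exact (continuousOn_inv_Icc_real Y).mul Real.continuous_sqrt.continuousOn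
  have hisq : IntervalIntegrable (fun t : ℝ ↦ t⁻¹ * Real.sqrt t) volume 1 Y := hsq_cont.intervalIntegrable
  have hiE : IntervalIntegrable (fun t : ℝ ↦ t⁻¹ * E t) volume 1 Y := by
    have : (fun t : ℝ ↦ t⁻¹ * E t) =
        fun t ↦ (t⁻¹ * P t - t⁻¹ * (Chebyshev.psi t / Real.sqrt t)) - t⁻¹ * Real.sqrt t := by
      funext t; simp only [hE]; ring
    rw [this]
    exact (hiP.sub hiψ).sub hisq
  -- evaluation of the pieces
  have hI1 : ∫ t in (1 : ℝ)..Y, t⁻¹ * P t = ∑ n ∈ Finset.Icc 1 ⌊Y⌋₊, Λ n / Real.sqrt n * Real.log (Y / n) :=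
    integral_inv_mul_primeCount_eq hY
  have hI2 : ∫ t in (1 : ℝ)..Y, t⁻¹ * Real.sqrt t = 2 * Real.sqrt Y - 2 := by
    have hderiv : ∀ t ∈ Set.uIcc 1 Y, HasDerivAt (fun t : ℝ ↦ 2 * Real.sqrt t) (t⁻¹ * Real.sqrt t) t := by
      intro t ht
      rw [Set.uIcc_of_le hY] at ht
      have ht0 : 0 < t := by linarith [ht.1]
      have hs0 : Real.sqrt t ≠ 0 := (Real.sqrt_pos.2 ht0).ne'
      have hst : Real.sqrt t * Real.sqrt t = t := Real.mul_self_sqrt ht0.le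
      refine ((Real.hasDerivAt_sqrt ht0.ne').const_mul 2).congr_deriv ?_
      rw [mul_one_div, ← div_div, div_self (two_ne_zero' ℝ), div_eq_iff hs0, mul_assoc, hst,
        inv_mul_cancel₀ ht0.ne']
    rw [intervalIntegral.integral_eq_sub_of_hasDerivAt hderiv hisq, Real.sqrt_one]
    ring
  have hI3 : |∫ t in (1 : ℝ)..Y, t⁻¹ * E t| ≤ |K| * Real.log Y := by
    have hb : ∀ᵐ t : ℝ, t ∈ Set.Ioc 1 Y → ‖t⁻¹ * E t‖ ≤ |K| * t⁻¹ := by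
      refine Filter.Eventually.of_forall fun t ht ↦ ?_
      have ht0 : 0 < t := by linarith [ht.1]
      rw [Real.norm_eq_abs, abs_mul, abs_of_pos (inv_pos.2 ht0), mul_comm]
      exact mul_le_mul_of_nonneg_right ((hEb t ht.1.le).trans (le_abs_self _)) (inv_nonneg.2 ht0.le)
    have hg : IntervalIntegrable (fun t : ℝ ↦ |K| * t⁻¹) volume 1 Y := by
      refine (ContinuousOn.intervalIntegrable ?_).const_mul |K|
      rw [Set.uIcc_of_le hY]
      exact continuousOn_inv_Icc_real Y
    have h := intervalIntegral.norm_integral_le_of_norm_le hY hb hg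
    rw [Real.norm_eq_abs, intervalIntegral.integral_const_mul, integral_inv_of_pos one_pos hY0, div_one] at h
    exact h
  -- the decomposition of the integral (`t/√t = √t`)
  have hsplit : ∫ t in (1 : ℝ)..Y, t⁻¹ * ((Chebyshev.psi t - t) / Real.sqrt t) =
      (∑ n ∈ Finset.Icc 1 ⌊Y⌋₊, Λ n / Real.sqrt n * Real.log (Y / n)) - 2 * (2 * Real.sqrt Y - 2)
        - ∫ t in (1 : ℝ)..Y, t⁻¹ * E t := by
    rw [← hI1, ← hI2, ← intervalIntegral.integral_const_mul, ← intervalIntegral.integral_sub hiP (hisq.const_mul 2),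
      ← intervalIntegral.integral_sub (hiP.sub (hisq.const_mul 2)) hiE]
    refine intervalIntegral.integral_congr fun t _ ↦ ?_
    simp only [hE]
    rw [sub_div, Real.div_sqrt]
    ring
  -- the `ζ` Riesz mean under RH
  have hmain : |(∑ n ∈ Finset.Icc 1 ⌊Y⌋₊, Λ n / Real.sqrt n * Real.log (Y / n)) - 4 * Real.sqrt Y| ≤
      |K₂| + Real.log Y * Lz := by
    have h1 := hK₂ Y hY1
    rw [halfLineSum_modOne] at h1
    set F : ℝ := ∑ n ∈ Finset.Icc 1 ⌊Y⌋₊, Λ n / Real.sqrt n * Real.log (Y / n)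
    have h2 : ‖(Real.log Y : ℂ) * logDeriv riemannZeta (1 / 2)‖ = Real.log Y * Lz := by
      rw [norm_mul, Complex.norm_real, Real.norm_eq_abs, abs_of_nonneg hlY]
    have h3 : |F - 4 * Real.sqrt Y| = ‖(((F - 4 * Real.sqrt Y : ℝ)) : ℂ)‖ := by
      rw [Complex.norm_real, Real.norm_eq_abs]
    rw [h3]
    calc ‖(((F - 4 * Real.sqrt Y : ℝ)) : ℂ)‖
        = ‖((F : ℂ) - 4 * Real.sqrt Y + (Real.log Y : ℂ) * logDeriv riemannZeta (1 / 2))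
            - (Real.log Y : ℂ) * logDeriv riemannZeta (1 / 2)‖ := by push_cast; ring_nf
      _ ≤ ‖(F : ℂ) - 4 * Real.sqrt Y + (Real.log Y : ℂ) * logDeriv riemannZeta (1 / 2)‖
            + ‖(Real.log Y : ℂ) * logDeriv riemannZeta (1 / 2)‖ := norm_sub_le _ _
      _ ≤ |K₂| + Real.log Y * Lz := by rw [h2]; exact add_le_add (h1.trans (le_abs_self _)) le_rfl
  rw [hsplit]
  have hsY : 0 ≤ Real.sqrt Y := Real.sqrt_nonneg Y
  have hi3' := hI3
  have habs : |(∑ n ∈ Finset.Icc 1 ⌊Y⌋₊, Λ n / Real.sqrt n * Real.log (Y / n)) - 2 * (2 * Real.sqrt Y - 2)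
      - ∫ t in (1 : ℝ)..Y, t⁻¹ * E t| ≤
      |(∑ n ∈ Finset.Icc 1 ⌊Y⌋₊, Λ n / Real.sqrt n * Real.log (Y / n)) - 4 * Real.sqrt Y| + 4
        + |∫ t in (1 : ℝ)..Y, t⁻¹ * E t| := by
    have e : (∑ n ∈ Finset.Icc 1 ⌊Y⌋₊, Λ n / Real.sqrt n * Real.log (Y / n)) - 2 * (2 * Real.sqrt Y - 2)
        - ∫ t in (1 : ℝ)..Y, t⁻¹ * E t =
        ((∑ n ∈ Finset.Icc 1 ⌊Y⌋₊, Λ n / Real.sqrt n * Real.log (Y / n)) - 4 * Real.sqrt Y) + 4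
          - ∫ t in (1 : ℝ)..Y, t⁻¹ * E t := by ring
    rw [e]
    refine (abs_sub _ _).trans ?_
    gcongr
    exact (abs_add_le _ _).trans (by norm_num)
  refine habs.trans ?_
  have hLz0 : 0 ≤ Lz := norm_nonneg _
  nlinarith [hmain, hI3, abs_nonneg K, abs_nonneg K₂]

/-- **Mean value of `A(t)/(t√t)` under GRH for every `χ` mod `q`**: `‖∫_1^Y A(t) dt/(t√t)‖ ≤ C(1 + log Y)` (`Y ≥ 1`),
`A(t) = (ψ(t) − t) + Σ_{χ ≠ χ₀} ψ(t, χ*)`. GRH-CONDITIONAL. [cite: Suzuki2025Chebyshev, §5.1 with §4.1 (4.5')] -/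
theorem exists_norm_integral_A_le (hGRH : ∀ χ : DirichletCharacter ℂ q, χ.RiemannHypothesis) :
    ∃ C : ℝ, 0 ≤ C ∧ ∀ Y : ℝ, 1 ≤ Y →
      ‖∫ t in (1 : ℝ)..Y, (t : ℂ)⁻¹ * ((∑ χ : DirichletCharacter ℂ q,
          (if χ = 1 then (((Chebyshev.psi t - t : ℝ)) : ℂ) else Sieve.chebyshevPsiChar χ.primitiveCharacter t))
            / (Real.sqrt t : ℂ))‖ ≤ C * (1 + Real.log Y) := by
  classical
  -- per-character data: an integrable `g_χ` with `O(log Y)` mean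
  have hdata : ∀ χ : DirichletCharacter ℂ q, ∃ C : ℝ, 0 ≤ C ∧ ∀ Y : ℝ, 1 ≤ Y →
      IntervalIntegrable (fun t : ℝ ↦ (t : ℂ)⁻¹ *
        ((if χ = 1 then (((Chebyshev.psi t - t : ℝ)) : ℂ) else Sieve.chebyshevPsiChar χ.primitiveCharacter t)
          / (Real.sqrt t : ℂ))) volume 1 Y ∧
      ‖∫ t in (1 : ℝ)..Y, (t : ℂ)⁻¹ *
        ((if χ = 1 then (((Chebyshev.psi t - t : ℝ)) : ℂ) else Sieve.chebyshevPsiChar χ.primitiveCharacter t)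
          / (Real.sqrt t : ℂ))‖ ≤ C * (1 + Real.log Y) := by
    intro χ
    by_cases hχ : χ = 1
    · subst hχ
      obtain ⟨C, hC0, hC⟩ := exists_abs_integral_psi_sub_le (riemannHypothesis_of_principal (hGRH 1))
      refine ⟨C, hC0, fun Y hY ↦ ?_⟩
      have hfun : (fun t : ℝ ↦ (t : ℂ)⁻¹ *
          ((if (1 : DirichletCharacter ℂ q) = 1 then (((Chebyshev.psi t - t : ℝ)) : ℂ)
            else Sieve.chebyshevPsiChar (1 : DirichletCharacter ℂ q).primitiveCharacter t) / (Real.sqrt t : ℂ))) =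
          fun t : ℝ ↦ (((t⁻¹ * ((Chebyshev.psi t - t) / Real.sqrt t) : ℝ)) : ℂ) := by
        funext t
        rw [if_pos rfl]
        push_cast
        ring
      rw [hfun, intervalIntegral.integral_ofReal, Complex.norm_real, Real.norm_eq_abs]
      refine ⟨?_, hC Y hY⟩
      have hre : IntervalIntegrable (fun t : ℝ ↦ t⁻¹ * ((Chebyshev.psi t - t) / Real.sqrt t)) volume 1 Y := by
        have hsq_cont : ContinuousOn (fun t : ℝ ↦ t⁻¹ * Real.sqrt t) (Set.uIcc 1 Y) := by
          rw [Set.uIcc_of_le hY]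
          exact (continuousOn_inv_Icc_real Y).mul Real.continuous_sqrt.continuousOn
        have h := (intervalIntegrable_inv_mul_psi hY).sub hsq_cont.intervalIntegrable
        refine h.congr fun t _ ↦ ?_
        show t⁻¹ * (Chebyshev.psi t / Real.sqrt t) - t⁻¹ * Real.sqrt t = t⁻¹ * ((Chebyshev.psi t - t) / Real.sqrt t)
        rw [sub_div, Real.div_sqrt]
        ring
      exact ⟨hre.1.ofReal, hre.2.ofReal⟩
    · haveI : NeZero χ.conductor := ⟨χ.conductor_ne_zero⟩
      have hN1 : 1 < χ.conductor := by
        have h1 : χ.conductor ≠ 1 := fun h ↦ hχ (DirichletCharacter.eq_one_iff_conductor_eq_one.2 h)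
        have h0 : χ.conductor ≠ 0 := χ.conductor_ne_zero
        omega
      have hprim := DirichletCharacter.primitiveCharacter_isPrimitive χ
      have hψGRH : χ.primitiveCharacter.RiemannHypothesis :=
        (DirichletCharacter.riemannHypothesis_iff_primitiveCharacter_holds χ).1 (hGRH χ)
      obtain ⟨C, hC0, hC⟩ := exists_norm_integral_psiChar_le hprim hN1 hψGRH
      refine ⟨C, hC0, fun Y hY ↦ ?_⟩
      simp only [if_neg hχ]
      exact ⟨intervalIntegrable_inv_mul_psiChar χ.primitiveCharacter hY, hC Y hY⟩
  choose C hC0 hC using hdata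
  refine ⟨∑ χ : DirichletCharacter ℂ q, C χ, Finset.sum_nonneg fun χ _ ↦ hC0 χ, fun Y hY ↦ ?_⟩
  have hfun : (fun t : ℝ ↦ (t : ℂ)⁻¹ * ((∑ χ : DirichletCharacter ℂ q,
      (if χ = 1 then (((Chebyshev.psi t - t : ℝ)) : ℂ) else Sieve.chebyshevPsiChar χ.primitiveCharacter t))
        / (Real.sqrt t : ℂ))) =
      fun t : ℝ ↦ ∑ χ : DirichletCharacter ℂ q, (t : ℂ)⁻¹ *
        ((if χ = 1 then (((Chebyshev.psi t - t : ℝ)) : ℂ) else Sieve.chebyshevPsiChar χ.primitiveCharacter t)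
          / (Real.sqrt t : ℂ)) := by
    funext t
    rw [Finset.sum_div, Finset.mul_sum]
  rw [hfun, intervalIntegral.integral_finsetSum fun χ _ ↦ (hC χ Y hY).1, Finset.sum_mul]
  exact (norm_sum_le _ _).trans (Finset.sum_le_sum fun χ _ ↦ (hC χ Y hY).2)


/-! ### §3 The only possible limit; the printed clause (v) and the named fact characterised -/

/-- `A(t)/(t√t)` is integrable on `[1, Y]` (unconditionally: step functions against continuous weights). [folklore] -/
private theorem intervalIntegrable_inv_mul_A {Y : ℝ} (hY : 1 ≤ Y) :
    IntervalIntegrable (fun t : ℝ ↦ (t : ℂ)⁻¹ * ((∑ χ : DirichletCharacter ℂ q,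
      (if χ = 1 then (((Chebyshev.psi t - t : ℝ)) : ℂ) else Sieve.chebyshevPsiChar χ.primitiveCharacter t))
        / (Real.sqrt t : ℂ))) volume 1 Y := by
  classical
  have hfun : (fun t : ℝ ↦ (t : ℂ)⁻¹ * ((∑ χ : DirichletCharacter ℂ q,
      (if χ = 1 then (((Chebyshev.psi t - t : ℝ)) : ℂ) else Sieve.chebyshevPsiChar χ.primitiveCharacter t))
        / (Real.sqrt t : ℂ))) =
      fun t : ℝ ↦ ∑ χ : DirichletCharacter ℂ q, (t : ℂ)⁻¹ *
        ((if χ = 1 then (((Chebyshev.psi t - t : ℝ)) : ℂ) else Sieve.chebyshevPsiChar χ.primitiveCharacter t)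
          / (Real.sqrt t : ℂ)) := by
    funext t
    rw [Finset.sum_div, Finset.mul_sum]
  rw [hfun, intervalIntegrable_iff_integrableOn_Ioc_of_le hY]
  refine MeasureTheory.integrable_finsetSum _ fun χ _ ↦ ?_
  refine (intervalIntegrable_iff_integrableOn_Ioc_of_le hY).1 ?_
  by_cases hχ : χ = 1
  · subst hχ
    have hfun1 : (fun t : ℝ ↦ (t : ℂ)⁻¹ *
        ((if (1 : DirichletCharacter ℂ q) = 1 then (((Chebyshev.psi t - t : ℝ)) : ℂ)
          else Sieve.chebyshevPsiChar (1 : DirichletCharacter ℂ q).primitiveCharacter t) / (Real.sqrt t : ℂ))) =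
        fun t : ℝ ↦ (((t⁻¹ * ((Chebyshev.psi t - t) / Real.sqrt t) : ℝ)) : ℂ) := by
      funext t
      rw [if_pos rfl]
      push_cast
      ring
    rw [hfun1]
    have hre : IntervalIntegrable (fun t : ℝ ↦ t⁻¹ * ((Chebyshev.psi t - t) / Real.sqrt t)) volume 1 Y := by
      have hsq_cont : ContinuousOn (fun t : ℝ ↦ t⁻¹ * Real.sqrt t) (Set.uIcc 1 Y) := by
        rw [Set.uIcc_of_le hY]
        exact (continuousOn_inv_Icc_real Y).mul Real.continuous_sqrt.continuousOn
      refine ((intervalIntegrable_inv_mul_psi hY).sub hsq_cont.intervalIntegrable).congr fun t _ ↦ ?_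
      show t⁻¹ * (Chebyshev.psi t / Real.sqrt t) - t⁻¹ * Real.sqrt t = t⁻¹ * ((Chebyshev.psi t - t) / Real.sqrt t)
      rw [sub_div, Real.div_sqrt]
      ring
    exact ⟨hre.1.ofReal, hre.2.ofReal⟩
  · simp only [if_neg hχ]
    exact intervalIntegrable_inv_mul_psiChar χ.primitiveCharacter hY

/-- `t ↦ (log t − 2)²/t` is continuous on `[a, b]`, `a ≥ 1`. [folklore] -/
private theorem continuousOn_log_sub_two_sq_mul_inv {a b : ℝ} (ha : 1 ≤ a) :
    ContinuousOn (fun t : ℝ ↦ (Real.log t - 2) ^ 2 * t⁻¹) (Set.Icc a b) := by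
  refine (((Real.continuousOn_log.mono fun t ht ↦ ?_).sub continuousOn_const).pow 2).mul
    (continuousOn_id.inv₀ fun t ht ↦ ?_)
  · simp only [Set.mem_compl_iff, Set.mem_singleton_iff]; linarith [ht.1]
  · simp only [id]; linarith [ht.1]

/-- `∫_a^b (log t − 2)² dt/t = ((log b − 2)³ − (log a − 2)³)/3` for `1 ≤ a ≤ b`. [folklore] -/
private theorem integral_log_sub_two_sq_mul_inv {a b : ℝ} (ha : 1 ≤ a) (hab : a ≤ b) :
    ∫ t in a..b, (Real.log t - 2) ^ 2 * t⁻¹ = ((Real.log b - 2) ^ 3 - (Real.log a - 2) ^ 3) / 3 := by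
  have hcont : ContinuousOn (fun t : ℝ ↦ (Real.log t - 2) ^ 2 * t⁻¹) (Set.uIcc a b) := by
    rw [Set.uIcc_of_le hab]
    exact continuousOn_log_sub_two_sq_mul_inv ha
  have hderiv : ∀ t ∈ Set.uIcc a b,
      HasDerivAt (fun t : ℝ ↦ (Real.log t - 2) ^ 3 / 3) ((Real.log t - 2) ^ 2 * t⁻¹) t := by
    intro t ht
    rw [Set.uIcc_of_le hab] at ht
    have ht0 : t ≠ 0 := by linarith [ht.1]
    have h1 := (((Real.hasDerivAt_log ht0).sub_const 2).pow 3).div_const 3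
    refine h1.congr_deriv ?_
    push_cast
    ring
  rw [intervalIntegral.integral_eq_sub_of_hasDerivAt hderiv hcont.intervalIntegrable]
  ring

/-- Step 1 of the uniqueness argument: under a limit `G(x)/log x → ℓ` (hence GRH), KEY ESTIMATE 1 gives, for large `y`,
`‖A(y)/(y√y) − κ(log y − 2)²/y‖ ≤ (|κ|/4)(log y − 2)²/y` with `κ = −(φ(q)ℓ + Σ_χ m_χ/2)/2 ≠ 0`. [folklore] -/
private theorem eventually_norm_sub_le_of_tendsto {ℓ : ℝ}
    (h : Tendsto (fun x : ℝ ↦ (1 / Real.log x) *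
        ∑ n ∈ (Finset.Icc 1 ⌊x * Real.exp 2⌋₊).filter (fun n : ℕ ↦ (n : ZMod q) = 1),
          Λ n / Real.sqrt n * (1 - Real.log n / Real.log x)) atTop (𝓝 ℓ))
    (hGRH : ∀ χ : DirichletCharacter ℂ q, χ.RiemannHypothesis) {κ : ℝ}
    (hκ : κ = -((q.totient : ℝ) * ℓ + (∑ χ : DirichletCharacter ℂ q, (DirichletDisc.zeroOrder χ (1 / 2) : ℝ)) / 2) / 2)
    (hκ0 : κ ≠ 0) :
    ∀ᶠ y : ℝ in atTop, ‖(y : ℂ)⁻¹ * ((∑ χ : DirichletCharacter ℂ q,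
        (if χ = 1 then (((Chebyshev.psi y - y : ℝ)) : ℂ) else Sieve.chebyshevPsiChar χ.primitiveCharacter y))
          / (Real.sqrt y : ℂ)) - (((κ * ((Real.log y - 2) ^ 2 * y⁻¹) : ℝ)) : ℂ)‖ ≤
      |κ| / 4 * ((Real.log y - 2) ^ 2 * y⁻¹) := by
  classical
  obtain ⟨c, -, B, hB⟩ := exists_norm_cutoff_sub_le hGRH
  have hφpos : (0 : ℝ) < q.totient := by exact_mod_cast Nat.totient_pos.mpr (NeZero.pos q)
  set φr : ℝ := (q.totient : ℝ) with hφr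
  set Mr : ℝ := ∑ χ : DirichletCharacter ℂ q, (DirichletDisc.zeroOrder χ (1 / 2) : ℝ) with hMr
  have hMc : ∑ χ : DirichletCharacter ℂ q, (DirichletDisc.zeroOrder χ (1 / 2) : ℂ) = ((Mr : ℝ) : ℂ) := by
    rw [hMr]; push_cast; rfl
  set S : ℂ := ∑ χ : DirichletCharacter ℂ q, c χ with hS
  have hκpos : 0 < |κ| := abs_pos.2 hκ0
  have hev1 := (Metric.tendsto_nhds.1 h) (|κ| / (4 * φr)) (by positivity)
  have hev2 := Real.tendsto_log_atTop.eventually_ge_atTop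
    (max 1 (4 * (3 * ‖S‖ + 2 * ‖((Mr : ℝ) : ℂ)‖ + |B|) / |κ|))
  apply eventually_of_mul_exp_two
  filter_upwards [hev1, hev2, eventually_gt_atTop (1 : ℝ)] with x hd hlogx hx1
  rw [Real.dist_eq] at hd
  have hx0 : 0 < x := by linarith
  set y := x * Real.exp 2 with hy
  have hy0 : 0 < y := by positivity
  have hsy : 0 < Real.sqrt y := Real.sqrt_pos.2 hy0
  have hlogy : Real.log y = Real.log x + 2 := by
    rw [hy, Real.log_mul hx0.ne' (Real.exp_pos 2).ne', Real.log_exp]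
  set L : ℝ := Real.log x with hL
  have hL0 : 0 < L := Real.log_pos hx1
  have hL1 : 1 ≤ L := le_trans (le_max_left _ _) hlogx
  have hLK : 4 * (3 * ‖S‖ + 2 * ‖((Mr : ℝ) : ℂ)‖ + |B|) / |κ| ≤ L := le_trans (le_max_right _ _) hlogx
  set G : ℝ := ∑ n ∈ (Finset.Icc 1 ⌊y⌋₊).filter (fun n : ℕ ↦ (n : ZMod q) = 1),
    Λ n / Real.sqrt n * (1 - Real.log n / L) with hG
  set g : ℝ := 1 / L * G with hg
  have hGg : G = L * g := by rw [hg]; field_simp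
  set A : ℂ := ∑ χ : DirichletCharacter ℂ q,
    (if χ = 1 then (((Chebyshev.psi y - y : ℝ)) : ℂ) else Sieve.chebyshevPsiChar χ.primitiveCharacter y) with hA
  have key : ‖(q.totient : ℂ) * (L : ℂ) * (G : ℂ) + (Real.log y : ℂ) * S
      + ((((Real.log y) ^ 2 / 2 - 2 * Real.log y : ℝ)) : ℂ) * ((Mr : ℝ) : ℂ) + 2 / (Real.sqrt y : ℂ) * A‖ ≤ B := by
    have := hB x hx1
    rw [hMc] at this
    exact this
  -- the identity behind KEY ESTIMATE 1
  have hid : (q.totient : ℂ) * (L : ℂ) * (G : ℂ) + (Real.log y : ℂ) * S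
      + ((((Real.log y) ^ 2 / 2 - 2 * Real.log y : ℝ)) : ℂ) * ((Mr : ℝ) : ℂ) + 2 / (Real.sqrt y : ℂ) * A =
      (2 / (Real.sqrt y : ℂ) * A - (((2 * κ * L ^ 2 : ℝ)) : ℂ))
        + ((((φr * L ^ 2 * (g - ℓ) : ℝ)) : ℂ) + (((L + 2 : ℝ)) : ℂ) * S - 2 * ((Mr : ℝ) : ℂ)) := by
    rw [hGg, hlogy, hκ, hφr]
    push_cast
    ring
  have hn1 : ‖2 / (Real.sqrt y : ℂ) * A - (((2 * κ * L ^ 2 : ℝ)) : ℂ)‖ ≤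
      B + (φr * L ^ 2 * |g - ℓ| + (L + 2) * ‖S‖ + 2 * ‖((Mr : ℝ) : ℂ)‖) := by
    have e : 2 / (Real.sqrt y : ℂ) * A - (((2 * κ * L ^ 2 : ℝ)) : ℂ) =
        ((q.totient : ℂ) * (L : ℂ) * (G : ℂ) + (Real.log y : ℂ) * S
          + ((((Real.log y) ^ 2 / 2 - 2 * Real.log y : ℝ)) : ℂ) * ((Mr : ℝ) : ℂ) + 2 / (Real.sqrt y : ℂ) * A)
        - ((((φr * L ^ 2 * (g - ℓ) : ℝ)) : ℂ) + (((L + 2 : ℝ)) : ℂ) * S - 2 * ((Mr : ℝ) : ℂ)) := by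
      rw [hid]; ring
    rw [e]
    refine (norm_sub_le _ _).trans (add_le_add key ?_)
    refine (norm_sub_le _ _).trans ?_
    refine (add_le_add (norm_add_le _ _) le_rfl).trans ?_
    have h1 : ‖(((φr * L ^ 2 * (g - ℓ) : ℝ)) : ℂ)‖ = φr * L ^ 2 * |g - ℓ| := by
      rw [Complex.norm_real, Real.norm_eq_abs, abs_mul, abs_of_pos (by positivity)]
    have h2 : ‖(((L + 2 : ℝ)) : ℂ) * S‖ = (L + 2) * ‖S‖ := by
      rw [norm_mul, Complex.norm_real, Real.norm_eq_abs, abs_of_pos (by linarith)]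
    have h3 : ‖(2 : ℂ) * ((Mr : ℝ) : ℂ)‖ = 2 * ‖((Mr : ℝ) : ℂ)‖ := by rw [norm_mul, Complex.norm_two]
    rw [h1, h2, h3]
  -- the two smallness facts
  have hsmall1 : φr * L ^ 2 * |g - ℓ| ≤ |κ| / 4 * L ^ 2 := by
    have h1 : φr * |g - ℓ| ≤ |κ| / 4 := by
      calc φr * |g - ℓ| ≤ φr * (|κ| / (4 * φr)) := mul_le_mul_of_nonneg_left hd.le hφpos.le
        _ = |κ| / 4 := by field_simp
    nlinarith [sq_nonneg L, h1]
  have hsmall2 : B + ((L + 2) * ‖S‖ + 2 * ‖((Mr : ℝ) : ℂ)‖) ≤ |κ| / 4 * L ^ 2 := by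
    have hS0 : 0 ≤ ‖S‖ := norm_nonneg _
    have hM0 : 0 ≤ ‖((Mr : ℝ) : ℂ)‖ := norm_nonneg _
    have h1 : B + ((L + 2) * ‖S‖ + 2 * ‖((Mr : ℝ) : ℂ)‖) ≤ (3 * ‖S‖ + 2 * ‖((Mr : ℝ) : ℂ)‖ + |B|) * L := by
      nlinarith [le_abs_self B, abs_nonneg B, mul_nonneg hS0 (by linarith : (0 : ℝ) ≤ L - 1),
        mul_nonneg hM0 (by linarith : (0 : ℝ) ≤ L - 1), mul_nonneg (abs_nonneg B) (by linarith : (0 : ℝ) ≤ L - 1)]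
    have h2 : 4 * (3 * ‖S‖ + 2 * ‖((Mr : ℝ) : ℂ)‖ + |B|) ≤ L * |κ| := (div_le_iff₀ hκpos).1 hLK
    nlinarith [h1, h2, hL0]
  have hn2 : ‖2 / (Real.sqrt y : ℂ) * A - (((2 * κ * L ^ 2 : ℝ)) : ℂ)‖ ≤ |κ| / 2 * L ^ 2 := by
    linarith [hn1, hsmall1, hsmall2]
  -- divide by `2y`
  have hlogy' : Real.log y - 2 = L := by rw [hlogy]; ring
  have hy0c : (y : ℂ) ≠ 0 := by exact_mod_cast hy0.ne'
  have hsyc : (Real.sqrt y : ℂ) ≠ 0 := by exact_mod_cast hsy.ne'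
  have e2 : (y : ℂ)⁻¹ * (A / (Real.sqrt y : ℂ)) - (((κ * (L ^ 2 * y⁻¹) : ℝ)) : ℂ) =
      (2 * (y : ℂ))⁻¹ * (2 / (Real.sqrt y : ℂ) * A - (((2 * κ * L ^ 2 : ℝ)) : ℂ)) := by
    push_cast
    field_simp
  rw [hlogy', e2, norm_mul, norm_inv, norm_mul, Complex.norm_two, Complex.norm_real, Real.norm_eq_abs,
    abs_of_pos hy0, show |κ| / 4 * (L ^ 2 * y⁻¹) = (2 * y)⁻¹ * (|κ| / 2 * L ^ 2) by field_simp; ring]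
  exact mul_le_mul_of_nonneg_left hn2 (by positivity)

/-- The cubic growth: `s³ ≤ (l + s)³ − l³` for `l, s ≥ 0`. [folklore] -/
private theorem cube_sub_cube_ge {l s : ℝ} (hl : 0 ≤ l) (hs : 0 ≤ s) : s ^ 3 ≤ (l + s) ^ 3 - l ^ 3 := by
  nlinarith [mul_nonneg (mul_nonneg hl hl) hs, mul_nonneg (mul_nonneg hl hs) hs]

/-- The final arithmetic: `κ s³/4 ≤ κΔ/4 ≤ C(2 + 2l + s)` is impossible for `s = 4C(2l + 3)/κ + 1`. [folklore] -/
private theorem false_of_cubic_le_linear {κ C l s Δ : ℝ} (hκ : 0 < κ) (hC : 0 ≤ C) (hl : 0 ≤ l)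
    (hs : s = 4 * C * (2 * l + 3) / κ + 1) (hΔs : s ^ 3 ≤ Δ)
    (h0 : κ / 4 * Δ ≤ C * (1 + (l + s)) + C * (1 + l)) : False := by
  have hs1 : 1 ≤ s := by
    have : 0 ≤ 4 * C * (2 * l + 3) / κ := by positivity
    rw [hs]; linarith
  have h2 : κ / 4 * s ^ 3 ≤ C * (2 * l + 3) * s := by
    have h3 : C * (1 + (l + s)) + C * (1 + l) ≤ C * (2 * l + 3) * s := by
      nlinarith [mul_nonneg (mul_nonneg hC (by linarith : (0 : ℝ) ≤ 2 * l + 2)) (by linarith : (0 : ℝ) ≤ s - 1)]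
    nlinarith [h0, h3, mul_le_mul_of_nonneg_left hΔs (by positivity : (0 : ℝ) ≤ κ / 4)]
  have h3 : κ / 4 * s ^ 2 ≤ C * (2 * l + 3) := by
    by_contra hlt
    have hlt' := lt_of_not_ge hlt
    have : C * (2 * l + 3) * s < κ / 4 * s ^ 2 * s := mul_lt_mul_of_pos_right hlt' (by linarith)
    nlinarith [h2, this]
  have h4 : κ / 4 * s ≤ κ / 4 * s ^ 2 := by
    nlinarith [mul_nonneg hκ.le (mul_nonneg (by linarith : (0 : ℝ) ≤ s) (by linarith : (0 : ℝ) ≤ s - 1))]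
  have h5 : κ * s = 4 * C * (2 * l + 3) + κ := by
    rw [hs]; field_simp
  nlinarith [h3, h4, h5, hκ]

/-- **The only possible limit of `G(x)/log x` is `−(2φ(q))^{-1}Σ_χ m_χ`.** If
`(1/log x) Σ_{n ≤ xe², n ≡ 1 (q)} Λ(n)n^{-1/2}(1 − log n/log x) → ℓ`, then `ℓ = −(2φ(q))^{-1}Σ_χ m_χ`: the limit forces GRH
(companion file, §9); under GRH the mean value `∫_1^Y A(t)dt/(t√t)` is `O(log Y)` (§2), while KEY ESTIMATE 1 turns the limit into
`‖A(y)/(y√y) − κ(log y − 2)²/y‖ ≤ (|κ|/4)(log y − 2)²/y` for large `y`, `κ = −(φ(q)ℓ + Σ_χ m_χ/2)/2`, whose integral over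
`[Y₀, Y₀eˢ]` grows like `s³`; hence `κ = 0`. (As-printed audit of (1.29); RH-FREE bookkeeping of a GRH-EQUIVALENCE; nothing
here bears on the truth of RH.) [cite: Suzuki2025Chebyshev, §1.3 Thm 6 (v) (1.29) and §5.1 (5.9) with §4.1 (4.5')] -/
theorem eq_of_tendsto_cutoff_div_log {ℓ : ℝ}
    (h : Tendsto (fun x : ℝ ↦ (1 / Real.log x) *
        ∑ n ∈ (Finset.Icc 1 ⌊x * Real.exp 2⌋₊).filter (fun n : ℕ ↦ (n : ZMod q) = 1),
          Λ n / Real.sqrt n * (1 - Real.log n / Real.log x)) atTop (𝓝 ℓ)) :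
    ℓ = -(1 / (2 * Nat.totient q) : ℝ) * ∑ χ : DirichletCharacter ℂ q, (DirichletDisc.zeroOrder χ (1 / 2) : ℝ) := by
  classical
  have hGRH := forall_riemannHypothesis_of_tendsto_cutoff_div_log h
  obtain ⟨C, hC0, hC⟩ := exists_norm_integral_A_le hGRH
  have hφpos : (0 : ℝ) < q.totient := by exact_mod_cast Nat.totient_pos.mpr (NeZero.pos q)
  set Mr : ℝ := ∑ χ : DirichletCharacter ℂ q, (DirichletDisc.zeroOrder χ (1 / 2) : ℝ) with hMr
  set κ : ℝ := -((q.totient : ℝ) * ℓ + Mr / 2) / 2 with hκ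
  by_contra hne
  have hκ0 : κ ≠ 0 := by
    intro h0
    apply hne
    have h1 : (q.totient : ℝ) * ℓ + Mr / 2 = 0 := by rw [hκ] at h0; linarith
    field_simp
    linarith
  have hκpos : 0 < |κ| := abs_pos.2 hκ0
  -- the functions `a(t) = A(t)/(t√t)` and `k(t) = κ(log t − 2)²/t`
  set a : ℝ → ℂ := fun t ↦ (t : ℂ)⁻¹ * ((∑ χ : DirichletCharacter ℂ q,
    (if χ = 1 then (((Chebyshev.psi t - t : ℝ)) : ℂ) else Sieve.chebyshevPsiChar χ.primitiveCharacter t))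
      / (Real.sqrt t : ℂ)) with ha
  set k : ℝ → ℝ := fun t ↦ κ * ((Real.log t - 2) ^ 2 * t⁻¹) with hk
  have hstep : ∀ᶠ y : ℝ in atTop, ‖a y - ((k y : ℝ) : ℂ)‖ ≤ |κ| / 4 * ((Real.log y - 2) ^ 2 * y⁻¹) :=
    eventually_norm_sub_le_of_tendsto h hGRH hκ hκ0
  -- Step 2: integrate from `Y₀` to `Y = Y₀eˢ`
  obtain ⟨Y₀, hY₀⟩ := Filter.eventually_atTop.1 (hstep.and (eventually_ge_atTop (Real.exp 3)))
  have hY₀3 : Real.exp 3 ≤ Y₀ := (hY₀ Y₀ le_rfl).2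
  have hY₀1 : 1 ≤ Y₀ := le_trans (by have := Real.add_one_le_exp (3 : ℝ); linarith) hY₀3
  have hY₀0 : 0 < Y₀ := by linarith
  have hlY₀ : 3 ≤ Real.log Y₀ := by
    have := Real.log_le_log (Real.exp_pos 3) hY₀3
    rwa [Real.log_exp] at this
  set s : ℝ := 4 * C * (2 * Real.log Y₀ + 3) / |κ| + 1 with hs
  have hs1 : 1 ≤ s := by
    have : 0 ≤ 4 * C * (2 * Real.log Y₀ + 3) / |κ| := by
      have : 0 ≤ 2 * Real.log Y₀ + 3 := by linarith
      positivity
    rw [hs]; linarith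
  set Y : ℝ := Y₀ * Real.exp s with hYdef
  have hYY₀ : Y₀ ≤ Y := by
    have : 1 ≤ Real.exp s := Real.one_le_exp_iff.2 (by linarith)
    rw [hYdef]; nlinarith
  have hY1 : 1 ≤ Y := le_trans hY₀1 hYY₀
  have hlogY : Real.log Y = Real.log Y₀ + s := by
    rw [hYdef, Real.log_mul hY₀0.ne' (Real.exp_pos s).ne', Real.log_exp]
  -- integrability
  have hia : ∀ Z : ℝ, 1 ≤ Z → IntervalIntegrable a volume 1 Z := fun Z hZ ↦ intervalIntegrable_inv_mul_A hZ
  have hia₀ : IntervalIntegrable a volume Y₀ Y :=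
    (hia Y hY1).mono_set (by
      rw [Set.uIcc_of_le hY1, Set.uIcc_of_le hYY₀]; exact Set.Icc_subset_Icc_left hY₀1)
  have hk_cont : ContinuousOn (fun t : ℝ ↦ ((k t : ℝ) : ℂ)) (Set.uIcc Y₀ Y) := by
    rw [Set.uIcc_of_le hYY₀]
    exact Complex.continuous_ofReal.comp_continuousOn
      (continuousOn_const.mul (continuousOn_log_sub_two_sq_mul_inv hY₀1))
  have hik : IntervalIntegrable (fun t : ℝ ↦ ((k t : ℝ) : ℂ)) volume Y₀ Y := hk_cont.intervalIntegrable
  -- upper bound from the mean value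
  have hsplit : ∫ t in Y₀..Y, a t = (∫ t in (1 : ℝ)..Y, a t) - ∫ t in (1 : ℝ)..Y₀, a t := by
    rw [← intervalIntegral.integral_add_adjacent_intervals (hia Y₀ hY₀1) hia₀]
    ring
  have hupper : ‖∫ t in Y₀..Y, a t‖ ≤ C * (1 + Real.log Y) + C * (1 + Real.log Y₀) := by
    rw [hsplit]
    exact (norm_sub_le _ _).trans (add_le_add (hC Y hY1) (hC Y₀ hY₀1))
  -- `∫ k = κΔ/3`, `‖∫ (a − k)‖ ≤ |κ|Δ/12`
  set Δ : ℝ := (Real.log Y - 2) ^ 3 - (Real.log Y₀ - 2) ^ 3 with hΔ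
  have hIk : ∫ t in Y₀..Y, ((k t : ℝ) : ℂ) = (((κ * (Δ / 3) : ℝ)) : ℂ) := by
    rw [intervalIntegral.integral_ofReal]
    simp only [hk]
    rw [intervalIntegral.integral_const_mul, integral_log_sub_two_sq_mul_inv hY₀1 hYY₀, hΔ]
  have hIdiff : ‖∫ t in Y₀..Y, (a t - ((k t : ℝ) : ℂ))‖ ≤ |κ| / 4 * (Δ / 3) := by
    have hb : ∀ᵐ t : ℝ, t ∈ Set.Ioc Y₀ Y → ‖a t - ((k t : ℝ) : ℂ)‖ ≤ |κ| / 4 * ((Real.log t - 2) ^ 2 * t⁻¹) :=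
      Filter.Eventually.of_forall fun t ht ↦ (hY₀ t ht.1.le).1
    have hg : IntervalIntegrable (fun t : ℝ ↦ |κ| / 4 * ((Real.log t - 2) ^ 2 * t⁻¹)) volume Y₀ Y := by
      refine (ContinuousOn.intervalIntegrable ?_).const_mul (|κ| / 4)
      rw [Set.uIcc_of_le hYY₀]
      exact continuousOn_log_sub_two_sq_mul_inv hY₀1
    refine (intervalIntegral.norm_integral_le_of_norm_le hYY₀ hb hg).trans (le_of_eq ?_)
    rw [intervalIntegral.integral_const_mul, integral_log_sub_two_sq_mul_inv hY₀1 hYY₀, hΔ]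
  have hΔs : s ^ 3 ≤ Δ := by
    have h1 := cube_sub_cube_ge (l := Real.log Y₀ - 2) (s := s) (by linarith) (by linarith)
    rw [hΔ, hlogY]
    convert h1 using 2
    ring
  have hΔ0 : 0 ≤ Δ := le_trans (pow_nonneg (by linarith) 3) hΔs
  -- lower bound `‖∫ a‖ ≥ |κ|Δ/3 − |κ|Δ/12`
  have hlower : |κ| * (Δ / 3) - |κ| / 4 * (Δ / 3) ≤ ‖∫ t in Y₀..Y, a t‖ := by
    have e : ∫ t in Y₀..Y, ((k t : ℝ) : ℂ) = (∫ t in Y₀..Y, a t) - ∫ t in Y₀..Y, (a t - ((k t : ℝ) : ℂ)) := by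
      rw [intervalIntegral.integral_sub hia₀ hik]; ring
    have hnk : ‖∫ t in Y₀..Y, ((k t : ℝ) : ℂ)‖ = |κ| * (Δ / 3) := by
      rw [hIk, Complex.norm_real, Real.norm_eq_abs, abs_mul, abs_of_nonneg (by positivity : (0 : ℝ) ≤ Δ / 3)]
    have h2 : ‖∫ t in Y₀..Y, ((k t : ℝ) : ℂ)‖ ≤
        ‖∫ t in Y₀..Y, a t‖ + ‖∫ t in Y₀..Y, (a t - ((k t : ℝ) : ℂ))‖ := by
      rw [e]; exact norm_sub_le _ _
    linarith [hnk, hIdiff, h2]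
  -- the contradiction
  have h0 : |κ| / 4 * Δ ≤ C * (1 + Real.log Y) + C * (1 + Real.log Y₀) := by linarith [hlower, hupper]
  rw [hlogY] at h0
  exact false_of_cubic_le_linear hκpos hC0 (by linarith : (0 : ℝ) ≤ Real.log Y₀) hs hΔs h0

/-- **The typed clause (v), AS PRINTED, characterised**: the limit statement of clause 4 of
`Suzuki2025Chebyshev_thm6_limits` (limit `−½ Σ_χ m_χ`, as printed in (1.29)) holds iff the GRH holds for every `χ` mod `q`,
AND `Σ_χ Σ_{ρ_{χ*}} x^ρ/ρ = o(√x log²x)` (1.30), AND (`φ(q) = 1` or `Σ_χ m_χ = 0`) — by `eq_of_tendsto_cutoff_div_log` and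
`Suzuki2025Chebyshev_thm6_v_corrected`. In particular the printed (1.29) is equivalent to «GRH ∧ (1.30)» exactly when, under
those, no `L(s, χ)` mod `q` vanishes at `½` or `q ≤ 2`. (As-printed audit, recorded for the referee; nothing here bears on
the truth of RH.) [cite: Suzuki2025Chebyshev, §1.3 Thm 6 (v) (1.29)–(1.30)] -/
theorem Suzuki2025Chebyshev_thm6_v_as_printed_iff :
    Tendsto (fun x : ℝ ↦ (1 / Real.log x) *
        ∑ n ∈ (Finset.Icc 1 ⌊x * Real.exp 2⌋₊).filter (fun n : ℕ ↦ (n : ZMod q) = 1),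
          Λ n / Real.sqrt n * (1 - Real.log n / Real.log x)) atTop
      (𝓝 (-(1 / 2 : ℝ) * ∑ χ : DirichletCharacter ℂ q, (DirichletDisc.zeroOrder χ (1 / 2) : ℝ))) ↔
      (∀ χ : DirichletCharacter ℂ q, χ.RiemannHypothesis) ∧
        (∀ ε : ℝ, 0 < ε → ∀ᶠ x : ℝ in atTop, ∀ᶠ T : ℝ in atTop,
          ‖∑ χ : DirichletCharacter ℂ q, charZeroSumTrunc χ x T‖ ≤ ε * (Real.sqrt x * Real.log x ^ 2)) ∧
        (Nat.totient q = 1 ∨ ∑ χ : DirichletCharacter ℂ q, (DirichletDisc.zeroOrder χ (1 / 2) : ℝ) = 0) := by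
  have hφpos : (0 : ℝ) < q.totient := by exact_mod_cast Nat.totient_pos.mpr (NeZero.pos q)
  set Mr : ℝ := ∑ χ : DirichletCharacter ℂ q, (DirichletDisc.zeroOrder χ (1 / 2) : ℝ) with hMr
  constructor
  · intro h
    have hℓ := eq_of_tendsto_cutoff_div_log h
    have hD : Nat.totient q = 1 ∨ Mr = 0 := by
      rcases eq_or_ne Mr 0 with hM | hM
      · exact Or.inr hM
      rcases eq_or_ne (Nat.totient q) 1 with hφ1 | hφ1
      · exact Or.inl hφ1
      exfalso
      have hφ1' : (q.totient : ℝ) ≠ 1 := by exact_mod_cast hφ1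
      have e : Mr * ((q.totient : ℝ) - 1) = 0 := by
        field_simp at hℓ
        linarith
      rcases mul_eq_zero.1 e with h1 | h1
      · exact hM h1
      · exact hφ1' (by linarith)
    exact ⟨((Suzuki2025Chebyshev_thm6_v_as_printed_of hD).1 h).1,
      ((Suzuki2025Chebyshev_thm6_v_as_printed_of hD).1 h).2, hD⟩
  · rintro ⟨hGRH, hZ, hD⟩
    exact (Suzuki2025Chebyshev_thm6_v_as_printed_of hD).2 ⟨hGRH, hZ⟩

/-- `Σ_χ m_χ = 0` iff no `L(s, χ)`, `χ` mod `q`, vanishes at `s = ½` (`m_{χ₀} = 0` always). [cite: Suzuki2025Chebyshev, §1.3,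
after Thm 6 («If `L(1/2, χ) ≠ 0` for all Dirichlet character `χ` modulo `q`, then the right-hand sides of (1.28) and (1.29)
vanish»)] -/
theorem sum_zeroOrder_eq_zero_iff :
    ∑ χ : DirichletCharacter ℂ q, (DirichletDisc.zeroOrder χ (1 / 2) : ℝ) = 0 ↔
      ∀ χ : DirichletCharacter ℂ q, χ.LFunction (1 / 2) ≠ 0 := by
  rw [Finset.sum_eq_zero_iff_of_nonneg fun χ _ ↦ Nat.cast_nonneg _]
  constructor
  · intro h χ
    by_cases hχ : χ = 1
    · subst hχ; exact LFunction_one_half_ne_zero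
    · intro h0
      have hpos := (DirichletDisc.zeroOrder_pos_iff χ hχ _).2 h0
      have h1 := h χ (Finset.mem_univ χ)
      rw [Nat.cast_eq_zero] at h1
      omega
  · intro h χ _
    by_cases hχ : χ = 1
    · subst hχ; rw [zeroOrder_one_half_eq_zero, Nat.cast_zero]
    · rw [zeroOrder_half_eq_zero hχ (h χ), Nat.cast_zero]

/-- **The named fact `Suzuki2025Chebyshev_thm6_limits`, AS TYPED (with the print's (1.28)/(1.29)), characterised**: it holds
iff for every modulus `q ≥ 1`, the GRH for all `χ` mod `q` implies `φ(q) = 1` or `L(½, χ) ≠ 0` for all `χ` mod `q`. (Clauses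
1–2 are the theorems `Suzuki2025Chebyshev_thm6_ii` / `Suzuki2025Chebyshev_thm6_limits_clause_iii`; clauses 3–4 as printed
reduce to this by `SuzukiThm6iv.Suzuki2025Chebyshev_thm6_iv_as_printed_iff` and `Suzuki2025Chebyshev_thm6_v_as_printed_iff`.
The right-hand side is an OPEN statement — non-vanishing of Dirichlet `L`-functions at the central point is expected but
unproved, even under GRH — so the typed fact is neither dischargeable nor refutable today; recorded for the referee, nothing
here bears on the truth of RH.) [cite: Suzuki2025Chebyshev, §1.3 Thm 6 (ii)–(v)] -/
theorem Suzuki2025Chebyshev_thm6_limits_iff :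
    Suzuki2025Chebyshev_thm6_limits ↔ ∀ (q : ℕ) [NeZero q],
      (∀ χ : DirichletCharacter ℂ q, χ.RiemannHypothesis) →
        (Nat.totient q = 1 ∨ ∀ χ : DirichletCharacter ℂ q, χ.LFunction (1 / 2) ≠ 0) := by
  constructor
  · rintro ⟨-, -, h3, -⟩ q _ hGRH
    have h := (SuzukiThm6iv.Suzuki2025Chebyshev_thm6_iv_as_printed_iff (q := q)).1 ((h3 q).2 hGRH)
    rcases h.2 with h1 | h1
    · exact Or.inl h1
    · exact Or.inr (sum_zeroOrder_eq_zero_iff.1 h1)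
  · intro h
    refine ⟨fun q _ hL ↦ Suzuki2025Chebyshev_thm6_ii hL, fun q _ hL ↦ Suzuki2025Chebyshev_thm6_iii hL,
      fun q _ ↦ ?_, fun q _ ↦ ?_⟩
    · rw [SuzukiThm6iv.Suzuki2025Chebyshev_thm6_iv_as_printed_iff]
      constructor
      · exact fun h' ↦ h'.1
      · intro hGRH
        refine ⟨hGRH, ?_⟩
        rcases h q hGRH with h1 | h1
        · exact Or.inl h1
        · exact Or.inr (sum_zeroOrder_eq_zero_iff.2 h1)
    · rw [Suzuki2025Chebyshev_thm6_v_as_printed_iff]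
      constructor
      · exact fun h' ↦ ⟨h'.1, h'.2.1⟩
      · rintro ⟨hGRH, hZ⟩
        refine ⟨hGRH, hZ, ?_⟩
        rcases h q hGRH with h1 | h1
        · exact Or.inl h1
        · exact Or.inr (sum_zeroOrder_eq_zero_iff.2 h1)

end AsPrinted

end SuzukiThm6vAsPrinted

end Literature.NumberTheory.LFunctions
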